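import Literature.Geometry.Riemannian.MetricFlowFDistanceExtendAux1
import Literature.Geometry.Riemannian.MetricFlowCorrespondenceChainAux
import HarnessLib

/-!
# Extending `𝔽`-distance estimates to larger time domains — the final estimate (Bamler 2023,
# §7.2, Lemma 7.? (arXiv v1 Lemma 160), last display of the proof)

R. Bamler, *Compactness theory of the space of super Ricci flows*, Invent. Math. 233 (2023), §7.2,
proof of Lemma 7.? (arXiv v1 Lemma 160), last display: for `s ≤ t` in `I₁` with near-future times
`s' ≤ t'` in `I₀`, the coupling `q_t = ∫ (ν¹_{·;t} ⊗ ν²_{·;t}) dq_{t'}` (7.15) and a comparison space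
`Z_s ⊇ Z_{s'}` receiving isometric embeddings `φ^i_s` of `𝒳^i_s` and `φ^i_{s'}` of `𝒳^i_{s'}` with
`∫_{𝒳^i_{s'}}∫_{𝒳^i_s} d^Z_s(φ^i_s x, φ^i_{s'} x') dν^i_{x';s}(x) dμ^i_{s'}(x') ≤ Ψ(δ)` (7.14'),
*"Using (7.15), (7.16), (7.17), we obtain
`∫ d_{W₁}^{Z_s}((φ¹_s)_* ν¹_{y¹;s}, (φ²_s)_* ν²_{y²;s}) dq_t(y¹, y²)
 = ∫_{q_{t'}} ∫_{ν¹_{y'¹;t}} ∫_{ν²_{y'²;t}} d_{W₁}^{Z_s}((φ¹_s)_* ν¹_{y¹;s}, (φ²_s)_* ν²_{y²;s})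
 ≤ ∫_{q_{t'}} ∫∫ (d_{W₁}^{Z_s}((φ¹_s)_* ν¹_{y¹;s}, (φ¹_s)_* ν¹_{y'¹;s}) + d_{W₁}^{Z_s}((φ¹_s)_* ν¹_{y'¹;s},
   (φ²_s)_* ν²_{y'²;s}) + d_{W₁}^{Z_s}((φ²_s)_* ν²_{y'²;s}, (φ²_s)_* ν²_{y²;s}))
 ≤ Ψ(δ) + ∫_{q_{t'}} d_{W₁}^{Z_s}((φ¹_s)_* ν¹_{y'¹;s}, (φ²_s)_* ν²_{y'²;s})
 ≤ Ψ(δ) + ∫_{q_{t'}} (d_{W₁}^{Z_s}((φ¹_s)_* ν¹_{y¹;s}, (φ¹_{s'})_* ν¹_{y¹;s'}) + d_{W₁}^{Z_s}((φ¹_{s'})_*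
   ν¹_{y¹;s'}, (φ²_{s'})_* ν²_{y²;s'}) + d_{W₁}^{Z_s}((φ²_{s'})_* ν²_{y²;s'}, (φ²_s)_* ν²_{y²;s}))
 ≤ Ψ(δ) + ∫_{q_{t'}} d_{W₁}^{Z_{s'}}((φ¹_{s'})_* ν¹_{y¹;s'}, (φ²_{s'})_* ν²_{y²;s'}) ≤ Ψ(δ)`."*

This auxiliary file proves that chain with explicit constants, for `H`-concentrated metric flow
pairs, an abstract comparison space `Z` at time `s` (isometric embeddings `φ₁, φ₂` of `𝒳¹_s, 𝒳²_s`
and `ψ₁, ψ₂` of `𝒳¹_{s'}, 𝒳²_{s'}`), and an abstract comparison space `Z₀` at time `s'` (embeddings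
`φ₀₁, φ₀₂`) with `d_Z(ψ₁ x, ψ₂ y) ≤ d_{Z₀}(φ₀₁ x, φ₀₂ y)` (which is what `Z_s ⊇ Z_{s'}` is used for):

* `MetricFlowPair.wassersteinW1_map_condKernel_le_add_add` — the first pointwise triangle
  inequality (through `(φ^i_s)_* ν^i_{y'^i;s}`), with `d_{W₁}^{Z_s}((φ_s)_* α, (φ_s)_* β) ≤ d_{W₁}^{𝒳_s}(α, β)`;
* `MetricFlowPair.wassersteinW1_map_condKernel_le_cost_add` — the second one (through
  `(φ^i_{s'})_* ν^i_{y^i;s'}`), combined with the pointwise step of (7.17) and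
  `d_{W₁}^{Z_s}((ψ₁)_* α, (ψ₂)_* β) ≤ d_{W₁}^{Z_{s'}}((φ₀₁)_* α, (φ₀₂)_* β)`;
* `MetricFlowPair.lintegral_lintegral_wassersteinW1_map_condKernel_le` — the inner integration
  against `ν¹_{y'¹;t} ⊗ ν²_{y'²;t}` using (7.16): `≤ 2√(H(t' − t)) + d_{W₁}^{Z_s}(…y'¹…, …y'²…)`;
* `MetricFlowPair.lintegral_extCoupling_wassersteinW1_map_le` — **the whole display**:
  `∫ d_{W₁}^{Z_s}((φ₁)_* ν¹_{y¹;s}, (φ₂)_* ν²_{y²;s}) dq_t ≤ 2√(Hδ) + 2Ψ + δ` when `t' − t ≤ δ`, the two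
  bounds (7.14') are `≤ Ψ` and `q_{t'}` is `δ`-admissible at `(s', t')` in `Z₀`.

Everything is proved; no definitions, no named facts.

## References

* R. H. Bamler, *Compactness theory of the space of super Ricci flows*, Invent. Math. 233 (2023),
  1121–1277 (arXiv:2008.09298), §7.2, Lemma 7.? (arXiv v1 Lemma 160), proof (last display).
  [Bamler2023]
-/

noncomputable section

open Set MeasureTheory ProbabilityTheory Filter TopologicalSpace Function
open scoped Topology ENNReal NNReal ProbabilityTheory

namespace Literature.Geometry.Riemannian

universe u

namespace MetricFlowPair

open MetricFlow

variable {J₁ J₂ : Set ℝ} {P₁ : MetricFlowPair.{u} J₁} {P₂ : MetricFlowPair.{u} J₂}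

/-- **First pointwise triangle inequality** of the last display of the proof of Lemma 7.?: for
`s ≤ t`, `s ≤ t'`, `y^i ∈ 𝒳^i_t`, `y'^i ∈ 𝒳^i_{t'}` and isometric embeddings `φ_i : 𝒳^i_s → Z`,
`d_{W₁}^Z((φ₁)_* ν¹_{y¹;s}, (φ₂)_* ν²_{y²;s}) ≤ d_{W₁}^{𝒳¹_s}(ν¹_{y¹;s}, ν¹_{y'¹;s}) +
d_{W₁}^Z((φ₁)_* ν¹_{y'¹;s}, (φ₂)_* ν²_{y'²;s}) + d_{W₁}^{𝒳²_s}(ν²_{y²;s}, ν²_{y'²;s})`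
(`wassersteinW1_map_triangle` twice, and push-forwards under one isometric embedding do not
increase `d_{W₁}`). [cite: Bamler2023, §7.2, Lemma 7.? (arXiv v1 Lemma 160), proof (last display)] -/
theorem wassersteinW1_map_condKernel_le_add_add {s t t' : ℝ} (hs₁ : s ∈ P₁.I') (hs₂ : s ∈ P₂.I')
    (ht₁ : t ∈ P₁.I') (ht₂ : t ∈ P₂.I') (ht'₁ : t' ∈ P₁.I') (ht'₂ : t' ∈ P₂.I') (hst : s ≤ t)
    (hst' : s ≤ t') {Z : Type*} [MetricSpace Z] [MeasurableSpace Z] [BorelSpace Z]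
    {φ₁ : P₁.flow.Slice ⟨s, hs₁⟩ → Z} {φ₂ : P₂.flow.Slice ⟨s, hs₂⟩ → Z} (hφ₁ : Isometry φ₁)
    (hφ₂ : Isometry φ₂) (y₁ : P₁.flow.Slice ⟨t, ht₁⟩) (y₂ : P₂.flow.Slice ⟨t, ht₂⟩)
    (y'₁ : P₁.flow.Slice ⟨t', ht'₁⟩) (y'₂ : P₂.flow.Slice ⟨t', ht'₂⟩) :
    wassersteinW1 ((P₁.flow.condKernel y₁ ⟨s, hs₁⟩).map φ₁)
        ((P₂.flow.condKernel y₂ ⟨s, hs₂⟩).map φ₂) ≤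
      wassersteinW1 (P₁.flow.condKernel y₁ ⟨s, hs₁⟩) (P₁.flow.condKernel y'₁ ⟨s, hs₁⟩) +
        wassersteinW1 ((P₁.flow.condKernel y'₁ ⟨s, hs₁⟩).map φ₁)
          ((P₂.flow.condKernel y'₂ ⟨s, hs₂⟩).map φ₂) +
        wassersteinW1 (P₂.flow.condKernel y₂ ⟨s, hs₂⟩) (P₂.flow.condKernel y'₂ ⟨s, hs₂⟩) := by
  haveI := P₁.flow.isProbabilityMeasure_condKernel (s := ⟨s, hs₁⟩) y₁ hst
  haveI := P₁.flow.isProbabilityMeasure_condKernel (s := ⟨s, hs₁⟩) y'₁ hst'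
  haveI := P₂.flow.isProbabilityMeasure_condKernel (s := ⟨s, hs₂⟩) y₂ hst
  haveI := P₂.flow.isProbabilityMeasure_condKernel (s := ⟨s, hs₂⟩) y'₂ hst'
  set ν₁ := P₁.flow.condKernel y₁ ⟨s, hs₁⟩ with hν₁
  set ν'₁ := P₁.flow.condKernel y'₁ ⟨s, hs₁⟩ with hν'₁
  set ν₂ := P₂.flow.condKernel y₂ ⟨s, hs₂⟩ with hν₂
  set ν'₂ := P₂.flow.condKernel y'₂ ⟨s, hs₂⟩ with hν'₂
  have h1 := wassersteinW1_map_triangle hφ₁ hφ₁ hφ₂ ν₁ ν'₁ ν₂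
  have h2 := wassersteinW1_map_triangle hφ₁ hφ₂ hφ₂ ν'₁ ν'₂ ν₂
  have e1 : wassersteinW1 (ν₁.map φ₁) (ν'₁.map φ₁) ≤ wassersteinW1 ν₁ ν'₁ :=
    wassersteinW1_map_le_of_edist_le hφ₁.continuous.measurable
      (fun a b ↦ (hφ₁.edist_eq a b).le) _ _
  have e2 : wassersteinW1 (ν'₂.map φ₂) (ν₂.map φ₂) ≤ wassersteinW1 ν₂ ν'₂ := by
    rw [wassersteinW1_comm ν₂]
    exact wassersteinW1_map_le_of_edist_le hφ₂.continuous.measurable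
      (fun a b ↦ (hφ₂.edist_eq a b).le) _ _
  calc wassersteinW1 (ν₁.map φ₁) (ν₂.map φ₂)
      ≤ wassersteinW1 (ν₁.map φ₁) (ν'₁.map φ₁) + wassersteinW1 (ν'₁.map φ₁) (ν₂.map φ₂) := h1
    _ ≤ wassersteinW1 ν₁ ν'₁ +
          (wassersteinW1 (ν'₁.map φ₁) (ν'₂.map φ₂) + wassersteinW1 ν₂ ν'₂) :=
        add_le_add e1 (h2.trans (add_le_add le_rfl e2))
    _ = _ := (add_assoc _ _ _).symm

/-- **Second pointwise triangle inequality** of the last display of the proof of Lemma 7.?,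
combined with the pointwise step of (7.17) and the comparison `Z_s ⊇ Z_{s'}`: for `s ≤ s' ≤ t'`,
`y'^i ∈ 𝒳^i_{t'}`, isometric embeddings `φ_i : 𝒳^i_s → Z`, `ψ_i : 𝒳^i_{s'} → Z`, `φ₀ᵢ : 𝒳^i_{s'} → Z₀`
with `d_Z(ψ₁ x, ψ₂ y) ≤ d_{Z₀}(φ₀₁ x, φ₀₂ y)`,
`d_{W₁}^Z((φ₁)_* ν¹_{y'¹;s}, (φ₂)_* ν²_{y'²;s}) ≤ ∫∫ d_Z(φ₁ x, ψ₁ x') dν¹_{x';s} dν¹_{y'¹;s'}(x') +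
d_{W₁}^{Z₀}((φ₀₁)_* ν¹_{y'¹;s'}, (φ₀₂)_* ν²_{y'²;s'}) + ∫∫ d_Z(φ₂ x, ψ₂ x') dν²_{x';s} dν²_{y'²;s'}(x')`.
[cite: Bamler2023, §7.2, Lemma 7.? (arXiv v1 Lemma 160), proof (last display)] -/
theorem wassersteinW1_map_condKernel_le_cost_add {s s' t' : ℝ} (hs₁ : s ∈ P₁.I')
    (hs₂ : s ∈ P₂.I') (hs'₁ : s' ∈ P₁.I') (hs'₂ : s' ∈ P₂.I') (ht'₁ : t' ∈ P₁.I')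
    (ht'₂ : t' ∈ P₂.I') (hss' : s ≤ s') (hs't' : s' ≤ t') {Z : Type*} [MetricSpace Z]
    [MeasurableSpace Z] [BorelSpace Z] {φ₁ : P₁.flow.Slice ⟨s, hs₁⟩ → Z}
    {φ₂ : P₂.flow.Slice ⟨s, hs₂⟩ → Z} {ψ₁ : P₁.flow.Slice ⟨s', hs'₁⟩ → Z}
    {ψ₂ : P₂.flow.Slice ⟨s', hs'₂⟩ → Z} (hφ₁ : Isometry φ₁) (hφ₂ : Isometry φ₂)
    (hψ₁ : Isometry ψ₁) (hψ₂ : Isometry ψ₂) {Z₀ : Type*} [MetricSpace Z₀] [MeasurableSpace Z₀]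
    [BorelSpace Z₀] {φ₀₁ : P₁.flow.Slice ⟨s', hs'₁⟩ → Z₀} {φ₀₂ : P₂.flow.Slice ⟨s', hs'₂⟩ → Z₀}
    (hφ₀₁ : Isometry φ₀₁) (hφ₀₂ : Isometry φ₀₂)
    (hψ : ∀ x y, edist (ψ₁ x) (ψ₂ y) ≤ edist (φ₀₁ x) (φ₀₂ y))
    (y'₁ : P₁.flow.Slice ⟨t', ht'₁⟩) (y'₂ : P₂.flow.Slice ⟨t', ht'₂⟩) :
    wassersteinW1 ((P₁.flow.condKernel y'₁ ⟨s, hs₁⟩).map φ₁)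
        ((P₂.flow.condKernel y'₂ ⟨s, hs₂⟩).map φ₂) ≤
      ∫⁻ x', ∫⁻ x, edist (φ₁ x) (ψ₁ x') ∂(P₁.flow.condKernel x' ⟨s, hs₁⟩)
          ∂(P₁.flow.condKernel y'₁ ⟨s', hs'₁⟩) +
        wassersteinW1 ((P₁.flow.condKernel y'₁ ⟨s', hs'₁⟩).map φ₀₁)
          ((P₂.flow.condKernel y'₂ ⟨s', hs'₂⟩).map φ₀₂) +
        ∫⁻ x', ∫⁻ x, edist (φ₂ x) (ψ₂ x') ∂(P₂.flow.condKernel x' ⟨s, hs₂⟩)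
          ∂(P₂.flow.condKernel y'₂ ⟨s', hs'₂⟩) := by
  haveI := P₁.flow.isProbabilityMeasure_condKernel (s := ⟨s, hs₁⟩) y'₁ (hss'.trans hs't')
  haveI := P₁.flow.isProbabilityMeasure_condKernel (s := ⟨s', hs'₁⟩) y'₁ hs't'
  haveI := P₂.flow.isProbabilityMeasure_condKernel (s := ⟨s, hs₂⟩) y'₂ (hss'.trans hs't')
  haveI := P₂.flow.isProbabilityMeasure_condKernel (s := ⟨s', hs'₂⟩) y'₂ hs't'
  set ν₁ := P₁.flow.condKernel y'₁ ⟨s, hs₁⟩ with hν₁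
  set ν'₁ := P₁.flow.condKernel y'₁ ⟨s', hs'₁⟩ with hν'₁
  set ν₂ := P₂.flow.condKernel y'₂ ⟨s, hs₂⟩ with hν₂
  set ν'₂ := P₂.flow.condKernel y'₂ ⟨s', hs'₂⟩ with hν'₂
  have h1 := wassersteinW1_map_triangle hφ₁ hψ₁ hφ₂ ν₁ ν'₁ ν₂
  have h2 := wassersteinW1_map_triangle hψ₁ hψ₂ hφ₂ ν'₁ ν'₂ ν₂
  have e1 : wassersteinW1 (ν₁.map φ₁) (ν'₁.map ψ₁) ≤
      ∫⁻ x', ∫⁻ x, edist (φ₁ x) (ψ₁ x') ∂(P₁.flow.condKernel x' ⟨s, hs₁⟩) ∂ν'₁ :=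
    wassersteinW1_map_condKernel_le (s := ⟨s, hs₁⟩) (s' := ⟨s', hs'₁⟩) hss' hs't' y'₁
      hφ₁.continuous hψ₁.continuous
  have e2 : wassersteinW1 (ν'₁.map ψ₁) (ν'₂.map ψ₂) ≤ wassersteinW1 (ν'₁.map φ₀₁) (ν'₂.map φ₀₂) :=
    wassersteinW1_map_map_le_of_edist_le hφ₀₁ hφ₀₂ hψ₁.continuous.measurable
      hψ₂.continuous.measurable hψ ν'₁ ν'₂
  have e3 : wassersteinW1 (ν'₂.map ψ₂) (ν₂.map φ₂) ≤
      ∫⁻ x', ∫⁻ x, edist (φ₂ x) (ψ₂ x') ∂(P₂.flow.condKernel x' ⟨s, hs₂⟩) ∂ν'₂ := by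
    rw [wassersteinW1_comm]
    exact wassersteinW1_map_condKernel_le (s := ⟨s, hs₂⟩) (s' := ⟨s', hs'₂⟩) hss' hs't' y'₂
      hφ₂.continuous hψ₂.continuous
  calc wassersteinW1 (ν₁.map φ₁) (ν₂.map φ₂)
      ≤ wassersteinW1 (ν₁.map φ₁) (ν'₁.map ψ₁) + wassersteinW1 (ν'₁.map ψ₁) (ν₂.map φ₂) := h1
    _ ≤ _ + (wassersteinW1 (ν'₁.map ψ₁) (ν'₂.map ψ₂) + wassersteinW1 (ν'₂.map ψ₂) (ν₂.map φ₂)) :=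
        add_le_add e1 h2
    _ ≤ _ + (wassersteinW1 (ν'₁.map φ₀₁) (ν'₂.map φ₀₂) + _) :=
        add_le_add le_rfl (add_le_add e2 e3)
    _ = _ := (add_assoc _ _ _).symm

/-- **The inner integration against `ν¹_{y'¹;t} ⊗ ν²_{y'²;t}`** in the last display of the proof of
Lemma 7.?, using (7.16) for both flows: for `s ≤ t ≤ t'`,
`∫∫ d_{W₁}^Z((φ₁)_* ν¹_{y¹;s}, (φ₂)_* ν²_{y²;s}) dν²_{y'²;t}(y²) dν¹_{y'¹;t}(y¹) ≤
2√(H(t' − t)) + d_{W₁}^Z((φ₁)_* ν¹_{y'¹;s}, (φ₂)_* ν²_{y'²;s})`.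
[cite: Bamler2023, §7.2, Lemma 7.? (arXiv v1 Lemma 160), proof (last display), (7.16)] -/
theorem lintegral_lintegral_wassersteinW1_map_condKernel_le {H : ℝ}
    (hH₁ : P₁.flow.IsHConcentrated H) (hH₂ : P₂.flow.IsHConcentrated H) {s t t' : ℝ}
    (hs₁ : s ∈ P₁.I') (hs₂ : s ∈ P₂.I') (ht₁ : t ∈ P₁.I') (ht₂ : t ∈ P₂.I') (ht'₁ : t' ∈ P₁.I')
    (ht'₂ : t' ∈ P₂.I') (hst : s ≤ t) (htt' : t ≤ t') {Z : Type*} [MetricSpace Z]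
    [MeasurableSpace Z] [BorelSpace Z] {φ₁ : P₁.flow.Slice ⟨s, hs₁⟩ → Z}
    {φ₂ : P₂.flow.Slice ⟨s, hs₂⟩ → Z} (hφ₁ : Isometry φ₁) (hφ₂ : Isometry φ₂)
    (y'₁ : P₁.flow.Slice ⟨t', ht'₁⟩) (y'₂ : P₂.flow.Slice ⟨t', ht'₂⟩) :
    ∫⁻ y₁, ∫⁻ y₂, wassersteinW1 ((P₁.flow.condKernel y₁ ⟨s, hs₁⟩).map φ₁)
        ((P₂.flow.condKernel y₂ ⟨s, hs₂⟩).map φ₂) ∂(P₂.flow.condKernel y'₂ ⟨t, ht₂⟩)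
        ∂(P₁.flow.condKernel y'₁ ⟨t, ht₁⟩) ≤
      2 * (ENNReal.ofReal (H * (t' - t))) ^ (1 / 2 : ℝ) +
        wassersteinW1 ((P₁.flow.condKernel y'₁ ⟨s, hs₁⟩).map φ₁)
          ((P₂.flow.condKernel y'₂ ⟨s, hs₂⟩).map φ₂) := by
  haveI := P₁.flow.isProbabilityMeasure_condKernel (s := ⟨t, ht₁⟩) y'₁ htt'
  haveI := P₂.flow.isProbabilityMeasure_condKernel (s := ⟨t, ht₂⟩) y'₂ htt'
  set R : ℝ≥0∞ := (ENNReal.ofReal (H * (t' - t))) ^ (1 / 2 : ℝ) with hR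
  set B := wassersteinW1 ((P₁.flow.condKernel y'₁ ⟨s, hs₁⟩).map φ₁)
    ((P₂.flow.condKernel y'₂ ⟨s, hs₂⟩).map φ₂) with hB
  set A₁ : P₁.flow.Slice ⟨t, ht₁⟩ → ℝ≥0∞ := fun y₁ ↦
    wassersteinW1 (P₁.flow.condKernel y₁ ⟨s, hs₁⟩) (P₁.flow.condKernel y'₁ ⟨s, hs₁⟩) with hA₁
  set A₂ : P₂.flow.Slice ⟨t, ht₂⟩ → ℝ≥0∞ := fun y₂ ↦
    wassersteinW1 (P₂.flow.condKernel y₂ ⟨s, hs₂⟩) (P₂.flow.condKernel y'₂ ⟨s, hs₂⟩) with hA₂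
  have hI₁ : ∫⁻ y₁, A₁ y₁ ∂(P₁.flow.condKernel y'₁ ⟨t, ht₁⟩) ≤ R :=
    hH₁.lintegral_wassersteinW1_condKernel_le (s := ⟨s, hs₁⟩) (t := ⟨t, ht₁⟩) (t' := ⟨t', ht'₁⟩)
      hst htt' y'₁
  have hI₂ : ∫⁻ y₂, A₂ y₂ ∂(P₂.flow.condKernel y'₂ ⟨t, ht₂⟩) ≤ R :=
    hH₂.lintegral_wassersteinW1_condKernel_le (s := ⟨s, hs₂⟩) (t := ⟨t, ht₂⟩) (t' := ⟨t', ht'₂⟩)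
      hst htt' y'₂
  calc ∫⁻ y₁, ∫⁻ y₂, wassersteinW1 ((P₁.flow.condKernel y₁ ⟨s, hs₁⟩).map φ₁)
        ((P₂.flow.condKernel y₂ ⟨s, hs₂⟩).map φ₂) ∂(P₂.flow.condKernel y'₂ ⟨t, ht₂⟩)
        ∂(P₁.flow.condKernel y'₁ ⟨t, ht₁⟩)
      ≤ ∫⁻ y₁, ∫⁻ y₂, (A₁ y₁ + B) + A₂ y₂ ∂(P₂.flow.condKernel y'₂ ⟨t, ht₂⟩)
          ∂(P₁.flow.condKernel y'₁ ⟨t, ht₁⟩) :=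
        lintegral_mono fun y₁ ↦ lintegral_mono fun y₂ ↦
          wassersteinW1_map_condKernel_le_add_add hs₁ hs₂ ht₁ ht₂ ht'₁ ht'₂ hst (hst.trans htt')
            hφ₁ hφ₂ y₁ y₂ y'₁ y'₂
    _ = ∫⁻ y₁, (A₁ y₁ + B) + ∫⁻ y₂, A₂ y₂ ∂(P₂.flow.condKernel y'₂ ⟨t, ht₂⟩)
          ∂(P₁.flow.condKernel y'₁ ⟨t, ht₁⟩) := by
        refine lintegral_congr fun y₁ ↦ ?_
        rw [lintegral_add_left measurable_const, lintegral_const, measure_univ, mul_one]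
    _ ≤ ∫⁻ y₁, A₁ y₁ + (B + R) ∂(P₁.flow.condKernel y'₁ ⟨t, ht₁⟩) :=
        lintegral_mono fun y₁ ↦ by rw [add_assoc]; exact add_le_add le_rfl (add_le_add le_rfl hI₂)
    _ = ∫⁻ y₁, A₁ y₁ ∂(P₁.flow.condKernel y'₁ ⟨t, ht₁⟩) + (B + R) := by
        rw [lintegral_add_right _ measurable_const, lintegral_const, measure_univ, mul_one]
    _ ≤ R + (B + R) := add_le_add hI₁ le_rfl
    _ = 2 * R + B := by ring

/-- **Bamler 2023, proof of Lemma 7.? (arXiv v1 Lemma 160), last display, with explicit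
constants.** Let `𝒳¹, 𝒳²` be `H`-concentrated metric flow pairs, `s ≤ t`, `s ≤ s' ≤ t'`, `t ≤ t'`
with `t' − t ≤ δ`; let `Z` be a metric space with isometric embeddings `φᵢ` of `𝒳^i_s` and `ψᵢ` of
`𝒳^i_{s'}` satisfying the bounds (7.14')
`∫_{𝒳^i_{s'}}∫_{𝒳^i_s} d_Z(φᵢ x, ψᵢ x') dν^i_{x';s}(x) dμ^i_{s'}(x') ≤ Ψ`, and `Z₀` a metric space with
isometric embeddings `φ₀ᵢ` of `𝒳^i_{s'}` such that `d_Z(ψ₁ x, ψ₂ y) ≤ d_{Z₀}(φ₀₁ x, φ₀₂ y)`; let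
`q_{t'}` be a coupling of `μ¹_{t'}, μ²_{t'}` with
`∫ d_{W₁}^{Z₀}((φ₀₁)_* ν¹_{y¹;s'}, (φ₀₂)_* ν²_{y²;s'}) dq_{t'} ≤ δ`. Then the coupling `q_t` of (7.15)
satisfies `∫ d_{W₁}^Z((φ₁)_* ν¹_{y¹;s}, (φ₂)_* ν²_{y²;s}) dq_t(y¹, y²) ≤ 2√(Hδ) + 2Ψ + δ`.
[cite: Bamler2023, §7.2, Lemma 7.? (arXiv v1 Lemma 160), proof (last display)] -/
theorem lintegral_extCoupling_wassersteinW1_map_le {H δ Ψ : ℝ} (hH0 : 0 ≤ H) (hδ : 0 ≤ δ)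
    (hΨ : 0 ≤ Ψ) (hH₁ : P₁.flow.IsHConcentrated H) (hH₂ : P₂.flow.IsHConcentrated H)
    {s s' t t' : ℝ} (hs₁ : s ∈ P₁.I') (hs₂ : s ∈ P₂.I') (hs'₁ : s' ∈ P₁.I') (hs'₂ : s' ∈ P₂.I')
    (ht₁ : t ∈ P₁.I') (ht₂ : t ∈ P₂.I') (ht'₁ : t' ∈ P₁.I') (ht'₂ : t' ∈ P₂.I')
    (hss' : s ≤ s') (hst : s ≤ t) (hs't' : s' ≤ t') (htt' : t ≤ t') (hδt : t' - t ≤ δ)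
    {Z : Type*} [MetricSpace Z] [MeasurableSpace Z] [BorelSpace Z]
    {φ₁ : P₁.flow.Slice ⟨s, hs₁⟩ → Z} {φ₂ : P₂.flow.Slice ⟨s, hs₂⟩ → Z}
    {ψ₁ : P₁.flow.Slice ⟨s', hs'₁⟩ → Z} {ψ₂ : P₂.flow.Slice ⟨s', hs'₂⟩ → Z}
    (hφ₁ : Isometry φ₁) (hφ₂ : Isometry φ₂) (hψ₁ : Isometry ψ₁) (hψ₂ : Isometry ψ₂)
    {Z₀ : Type*} [MetricSpace Z₀] [MeasurableSpace Z₀] [BorelSpace Z₀]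
    {φ₀₁ : P₁.flow.Slice ⟨s', hs'₁⟩ → Z₀} {φ₀₂ : P₂.flow.Slice ⟨s', hs'₂⟩ → Z₀}
    (hφ₀₁ : Isometry φ₀₁) (hφ₀₂ : Isometry φ₀₂)
    (hψ : ∀ x y, edist (ψ₁ x) (ψ₂ y) ≤ edist (φ₀₁ x) (φ₀₂ y))
    (hb₁ : ∫⁻ x', ∫⁻ x, edist (φ₁ x) (ψ₁ x') ∂(P₁.flow.condKernel x' ⟨s, hs₁⟩) ∂(P₁.μ ⟨s', hs'₁⟩) ≤
      ENNReal.ofReal Ψ)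
    (hb₂ : ∫⁻ x', ∫⁻ x, edist (φ₂ x) (ψ₂ x') ∂(P₂.flow.condKernel x' ⟨s, hs₂⟩) ∂(P₂.μ ⟨s', hs'₂⟩) ≤
      ENNReal.ofReal Ψ)
    {q₀ : Measure (P₁.flow.Slice ⟨t', ht'₁⟩ × P₂.flow.Slice ⟨t', ht'₂⟩)}
    (hq₀ : IsCoupling (P₁.μ ⟨t', ht'₁⟩) (P₂.μ ⟨t', ht'₂⟩) q₀)
    (hadm : ∫⁻ p, wassersteinW1 ((P₁.flow.condKernel p.1 ⟨s', hs'₁⟩).map φ₀₁)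
      ((P₂.flow.condKernel p.2 ⟨s', hs'₂⟩).map φ₀₂) ∂q₀ ≤ ENNReal.ofReal δ) :
    ∫⁻ p, wassersteinW1 ((P₁.flow.condKernel p.1 ⟨s, hs₁⟩).map φ₁)
        ((P₂.flow.condKernel p.2 ⟨s, hs₂⟩).map φ₂) ∂(extCoupling P₁ P₂ ht₁ ht₂ ht'₁ ht'₂ htt' q₀) ≤
      ENNReal.ofReal (2 * Real.sqrt (H * δ) + 2 * Ψ + δ) := by
  obtain ⟨hq₀P, hq₀1, hq₀2⟩ := hq₀
  haveI := hq₀P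
  set R : ℝ≥0∞ := (ENNReal.ofReal (H * (t' - t))) ^ (1 / 2 : ℝ) with hR
  set C₁ : P₁.flow.Slice ⟨t', ht'₁⟩ → ℝ≥0∞ := fun y'₁ ↦
    ∫⁻ x', ∫⁻ x, edist (φ₁ x) (ψ₁ x') ∂(P₁.flow.condKernel x' ⟨s, hs₁⟩)
      ∂(P₁.flow.condKernel y'₁ ⟨s', hs'₁⟩) with hC₁
  set C₂ : P₂.flow.Slice ⟨t', ht'₂⟩ → ℝ≥0∞ := fun y'₂ ↦
    ∫⁻ x', ∫⁻ x, edist (φ₂ x) (ψ₂ x') ∂(P₂.flow.condKernel x' ⟨s, hs₂⟩)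
      ∂(P₂.flow.condKernel y'₂ ⟨s', hs'₂⟩) with hC₂
  set D₀ : P₁.flow.Slice ⟨t', ht'₁⟩ × P₂.flow.Slice ⟨t', ht'₂⟩ → ℝ≥0∞ := fun p ↦
    wassersteinW1 ((P₁.flow.condKernel p.1 ⟨s', hs'₁⟩).map φ₀₁)
      ((P₂.flow.condKernel p.2 ⟨s', hs'₂⟩).map φ₀₂) with hD₀
  have hC₁m : Measurable C₁ :=
    measurable_condKernelCost (s := ⟨s, hs₁⟩) (s' := ⟨s', hs'₁⟩) (t' := ⟨t', ht'₁⟩) hss' hs't'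
      hφ₁.continuous hψ₁.continuous
  have hC₂m : Measurable C₂ :=
    measurable_condKernelCost (s := ⟨s, hs₂⟩) (s' := ⟨s', hs'₂⟩) (t' := ⟨t', ht'₂⟩) hss' hs't'
      hφ₂.continuous hψ₂.continuous
  -- the pointwise bound against `q_{t'}`
  have hpt : ∀ p' : P₁.flow.Slice ⟨t', ht'₁⟩ × P₂.flow.Slice ⟨t', ht'₂⟩,
      ∫⁻ y₁, ∫⁻ y₂, wassersteinW1 ((P₁.flow.condKernel y₁ ⟨s, hs₁⟩).map φ₁)
        ((P₂.flow.condKernel y₂ ⟨s, hs₂⟩).map φ₂) ∂(P₂.flow.condKernel p'.2 ⟨t, ht₂⟩)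
        ∂(P₁.flow.condKernel p'.1 ⟨t, ht₁⟩) ≤ (2 * R + C₁ p'.1 + C₂ p'.2) + D₀ p' := fun p' ↦
    calc _ ≤ 2 * R + wassersteinW1 ((P₁.flow.condKernel p'.1 ⟨s, hs₁⟩).map φ₁)
          ((P₂.flow.condKernel p'.2 ⟨s, hs₂⟩).map φ₂) :=
          lintegral_lintegral_wassersteinW1_map_condKernel_le hH₁ hH₂ hs₁ hs₂ ht₁ ht₂ ht'₁ ht'₂ hst
            htt' hφ₁ hφ₂ p'.1 p'.2
      _ ≤ 2 * R + (C₁ p'.1 + D₀ p' + C₂ p'.2) :=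
          add_le_add le_rfl (wassersteinW1_map_condKernel_le_cost_add hs₁ hs₂ hs'₁ hs'₂ ht'₁ ht'₂
            hss' hs't' hφ₁ hφ₂ hψ₁ hψ₂ hφ₀₁ hφ₀₂ hψ p'.1 p'.2)
      _ = (2 * R + C₁ p'.1 + C₂ p'.2) + D₀ p' := by ring
  -- the three integrals against `q_{t'}`
  have hJ₁ : ∫⁻ p', C₁ p'.1 ∂q₀ ≤ ENNReal.ofReal Ψ := by
    calc ∫⁻ p', C₁ p'.1 ∂q₀
        = ∫⁻ y, C₁ y ∂(q₀.map Prod.fst) := (lintegral_map hC₁m measurable_fst).symm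
      _ = ∫⁻ y, C₁ y ∂(P₁.μ ⟨t', ht'₁⟩) := by rw [← Measure.fst, hq₀1]
      _ = ∫⁻ x', ∫⁻ x, edist (φ₁ x) (ψ₁ x') ∂(P₁.flow.condKernel x' ⟨s, hs₁⟩) ∂(P₁.μ ⟨s', hs'₁⟩) :=
          P₁.isConjugateHeatFlow.lintegral_lintegral_condKernel_eq (s' := ⟨s', hs'₁⟩)
            (t' := ⟨t', ht'₁⟩) hs'₁ ht'₁ hs't'
            (measurable_lintegral_edist_condKernel (s := ⟨s, hs₁⟩) (s' := ⟨s', hs'₁⟩) hss'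
              hφ₁.continuous hψ₁.continuous)
      _ ≤ ENNReal.ofReal Ψ := hb₁
  have hJ₂ : ∫⁻ p', C₂ p'.2 ∂q₀ ≤ ENNReal.ofReal Ψ := by
    calc ∫⁻ p', C₂ p'.2 ∂q₀
        = ∫⁻ y, C₂ y ∂(q₀.map Prod.snd) := (lintegral_map hC₂m measurable_snd).symm
      _ = ∫⁻ y, C₂ y ∂(P₂.μ ⟨t', ht'₂⟩) := by rw [← Measure.snd, hq₀2]
      _ = ∫⁻ x', ∫⁻ x, edist (φ₂ x) (ψ₂ x') ∂(P₂.flow.condKernel x' ⟨s, hs₂⟩) ∂(P₂.μ ⟨s', hs'₂⟩) :=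
          P₂.isConjugateHeatFlow.lintegral_lintegral_condKernel_eq (s' := ⟨s', hs'₂⟩)
            (t' := ⟨t', ht'₂⟩) hs'₂ ht'₂ hs't'
            (measurable_lintegral_edist_condKernel (s := ⟨s, hs₂⟩) (s' := ⟨s', hs'₂⟩) hss'
              hφ₂.continuous hψ₂.continuous)
      _ ≤ ENNReal.ofReal Ψ := hb₂
  have hRle : R ≤ ENNReal.ofReal (Real.sqrt (H * δ)) := by
    calc R ≤ (ENNReal.ofReal (H * δ)) ^ (1 / 2 : ℝ) :=
          ENNReal.rpow_le_rpow (ENNReal.ofReal_le_ofReal (mul_le_mul_of_nonneg_left hδt hH0))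
            (by norm_num)
      _ = ENNReal.ofReal (Real.sqrt (H * δ)) := by
          rw [ENNReal.ofReal_rpow_of_nonneg (by positivity) (by norm_num), Real.sqrt_eq_rpow]
  have hmeas : Measurable fun p' : P₁.flow.Slice ⟨t', ht'₁⟩ × P₂.flow.Slice ⟨t', ht'₂⟩ ↦
      2 * R + C₁ p'.1 + C₂ p'.2 :=
    (measurable_const.add (hC₁m.comp measurable_fst)).add (hC₂m.comp measurable_snd)
  -- assemble
  calc ∫⁻ p, wassersteinW1 ((P₁.flow.condKernel p.1 ⟨s, hs₁⟩).map φ₁)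
        ((P₂.flow.condKernel p.2 ⟨s, hs₂⟩).map φ₂) ∂(extCoupling P₁ P₂ ht₁ ht₂ ht'₁ ht'₂ htt' q₀)
      ≤ ∫⁻ p', ∫⁻ y₁, ∫⁻ y₂, wassersteinW1 ((P₁.flow.condKernel y₁ ⟨s, hs₁⟩).map φ₁)
          ((P₂.flow.condKernel y₂ ⟨s, hs₂⟩).map φ₂) ∂(P₂.flow.condKernel p'.2 ⟨t, ht₂⟩)
          ∂(P₁.flow.condKernel p'.1 ⟨t, ht₁⟩) ∂q₀ :=
        lintegral_extCoupling_le ht₁ ht₂ ht'₁ ht'₂ htt' q₀ _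
    _ ≤ ∫⁻ p', (2 * R + C₁ p'.1 + C₂ p'.2) + D₀ p' ∂q₀ := lintegral_mono hpt
    _ = ∫⁻ p', (2 * R + C₁ p'.1 + C₂ p'.2) ∂q₀ + ∫⁻ p', D₀ p' ∂q₀ := lintegral_add_left hmeas _
    _ = (2 * R + ∫⁻ p', C₁ p'.1 ∂q₀ + ∫⁻ p', C₂ p'.2 ∂q₀) + ∫⁻ p', D₀ p' ∂q₀ := by
        have hm₁ : Measurable fun p' : P₁.flow.Slice ⟨t', ht'₁⟩ × P₂.flow.Slice ⟨t', ht'₂⟩ ↦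
            2 * R + C₁ p'.1 := measurable_const.add (hC₁m.comp measurable_fst)
        rw [lintegral_add_left hm₁, lintegral_add_left measurable_const, lintegral_const,
          measure_univ, mul_one]
    _ ≤ (2 * ENNReal.ofReal (Real.sqrt (H * δ)) + ENNReal.ofReal Ψ + ENNReal.ofReal Ψ) +
          ENNReal.ofReal δ := by
        gcongr
    _ = ENNReal.ofReal (2 * Real.sqrt (H * δ) + 2 * Ψ + δ) := by
        rw [ENNReal.ofReal_add (by positivity) hδ, ENNReal.ofReal_add (by positivity) (by positivity),
          ENNReal.ofReal_mul zero_le_two, ENNReal.ofReal_mul zero_le_two, ENNReal.ofReal_ofNat]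
        ring

end MetricFlowPair

end Literature.Geometry.Riemannian

end
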